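import Summits.CriticalPhenomena.PercolationContinuityZ3.Theorems.PercNearOneGluingAdditiveGluingOneBond
import Summits.CriticalPhenomena.PercolationContinuityZ3.Theorems.PercNearOneGluingNoHeavyLowerTailIncStarRootEdgeInduction
import Literature.Probability.Percolation.Percolation
import Literature.Probability.Percolation.PercolationEvents
import HarnessLib

/-!
# W-domination at a PENDANT target: the tight fibre of the WDOM conjecture is a theorem (Sahi programme, prover prim-sahi-p2 gen 34)

Support file (`--supports stmt-CriticalPhenomena-4575`).  No definitions, no named facts, no sorries; standard axioms.
Memo `run/shared/lean/prim/prim-sahi/FROM-prim-sahi-p2-gen34-WDOM.md` §6b, `prim-sahi-p2/PROOF-E3.md` §44.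

The W-domination conjecture (memo §1): for a root `s` and targets `i, j`, the statistic `W = 2·1{i,j ∈ C_s} − q_i·1{j ∈ C_s} − q_j·1{i ∈ C_s}`
(`q_v = P(s ↔ v)`) is positively correlated with EVERY increasing function of the cluster SET `C_s`; at `f = 1{s ↔ k}` this is the independent-copy comparison
`(P_k)`, which alone gives the increasing star (`IncStar.incStar_nonneg_of_pk`).  Its census-sharp fibre is a target hanging off the root by a single pair.
Here that fibre is proved: **`wdom_pendant`** — if every pair at `j` other than `s(s,j)` has weight `0`, then for every up-closed family `𝒜` of vertex sets, with
`A = {ω | C_s(ω) ∈ 𝒜}`,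
`2·P(A ∩ {s↔i} ∩ {s↔j}) − q_j·P(A ∩ {s↔i}) − q_i·P(A ∩ {s↔j}) − (2 q_{ij} − 2 q_i q_j)·P(A) ≥ 0`.
Proof: one-bond decomposition in `e = s(s,j)` (`stub_oneBondDecomp_k15`), the pushforward `P_{w[e↦0]} ∘ insert e = P_{w[e↦1]}`
(`goodStepEI_prodBernoulli_map_insert`), the almost-sure identities "`j` isolated under `w[e↦0]`" / "`C_s(ω ∪ {e}) = C_s(ω) ∪ {j}`"
(`reachable_insert_pendant`), and Harris' inequality for the two up-sets `{C_s ∪ {j} ∈ 𝒜}`, `{s↔i}`; the remaining real inequality is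
`(2−r)x₁ − (1−r)x₀ − q y₁ ≥ 0` from `x₁ ≥ q y₁`, `x₁ ≥ x₀`.
-/

noncomputable section

namespace Summit.CriticalPhenomena.PercolationContinuityZ3.Theorems

namespace IncStar

open MeasureTheory Set Literature.Probability.Percolation Literature.Probability.LatticeModels
open scoped Classical

variable {n : ℕ}

/-! ### Graph lemmas: a pendant pair at `j` -/

/-- If no pair at `j` is open, `j ≠ s` is not reached from `s`. [folklore] -/
theorem not_reachable_of_isolated {ω : BondConfig (Fin n)} {s j : Fin n} (hjs : j ≠ s)
    (hiso : ∀ v : Fin n, s(j, v) ∉ ω) : ¬ (openGraph ω).Reachable s j := by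
  intro h
  rw [SimpleGraph.reachable_iff_reflTransGen] at h
  rcases Relation.ReflTransGen.cases_tail h with h0 | ⟨z, -, hzj⟩
  · exact hjs h0
  · rw [openGraph_adj] at hzj
    have : s(j, z) ∈ ω := by rw [Sym2.eq_swap]; exact hzj.1
    exact hiso z this

/-- **Pendant insertion.**  If every pair at `j` other than `s(s,j)` is closed in `ω`, then after opening `e = s(s,j)` a vertex `y ≠ j` is reached from `s`
iff it was reached before. [folklore] -/
theorem reachable_insert_pendant {ω : BondConfig (Fin n)} {s j : Fin n} (hjs : j ≠ s)
    (hiso : ∀ v : Fin n, v ≠ s → s(j, v) ∉ ω) {y : Fin n} (hy : y ≠ j) :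
    (openGraph (insert s(s, j) ω)).Reachable s y ↔ (openGraph ω).Reachable s y := by
  constructor
  · intro h
    -- the set `K = C_s(ω) ∪ {j}` is closed under adjacency in the bigger graph
    have key : ∀ z : Fin n, Relation.ReflTransGen (openGraph (insert s(s, j) ω)).Adj s z →
        z = j ∨ (openGraph ω).Reachable s z := by
      intro z hz
      induction hz with
      | refl => exact Or.inr (SimpleGraph.Reachable.refl s)
      | @tail b c _ hbc ih =>
        rw [openGraph_adj, Set.mem_insert_iff] at hbc
        obtain ⟨hbc | hbc, hne⟩ := hbc
        · -- the new pair: {b,c} = {s,j}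
          rw [Sym2.eq_iff] at hbc
          rcases hbc with ⟨_, hc⟩ | ⟨_, hc⟩
          · exact Or.inl hc
          · subst hc
            exact Or.inr (SimpleGraph.Reachable.refl _)
        · rcases ih with hb | hb
          · -- b = j and s(j,c) ∈ ω forces c = s
            rw [hb] at hbc
            by_cases hcs : c = s
            · subst hcs
              exact Or.inr (SimpleGraph.Reachable.refl _)
            · exact absurd hbc (hiso c hcs)
          · right
            have hadj : (openGraph ω).Adj b c := by rw [openGraph_adj]; exact ⟨hbc, hne⟩
            exact hb.trans hadj.reachable
    rw [SimpleGraph.reachable_iff_reflTransGen] at h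
    rcases key y h with h1 | h1
    · exact absurd h1 hy
    · exact h1
  · intro h
    exact h.mono (openGraph_mono (Set.subset_insert _ _))

/-- After opening `s(s,j)` (`j ≠ s`), `j` is reached from `s`. [folklore] -/
theorem reachable_insert_self {ω : BondConfig (Fin n)} {s j : Fin n} (hjs : j ≠ s) :
    (openGraph (insert s(s, j) ω)).Reachable s j := by
  have hadj : (openGraph (insert s(s, j) ω)).Adj s j := by
    rw [openGraph_adj]; exact ⟨Set.mem_insert _ _, hjs.symm⟩
  exact hadj.reachable

/-- Under the pendant hypothesis, opening `s(s,j)` adds exactly `j` to the cluster of `s`. [this work] -/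
theorem openCluster_insert_pendant {ω : BondConfig (Fin n)} {s j : Fin n} (hjs : j ≠ s)
    (hiso : ∀ v : Fin n, v ≠ s → s(j, v) ∉ ω) :
    openCluster (insert s(s, j) ω) s = insert j (openCluster ω s) := by
  ext y
  simp only [openCluster, Set.mem_setOf_eq, Set.mem_insert_iff]
  by_cases hy : y = j
  · subst hy
    simp only [true_or, iff_true]
    exact reachable_insert_self hjs
  · rw [reachable_insert_pendant hjs hiso hy]
    simp [hy]

/-! ### The cluster events -/

/-- The event "the cluster of `s` lies in the up-closed family `𝒜`" is increasing. [folklore] -/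
theorem isUpperSet_clusterMem (s : Fin n) {𝒜 : Set (Set (Fin n))} (h𝒜 : ∀ S T : Set (Fin n), S ∈ 𝒜 → S ⊆ T → T ∈ 𝒜) :
    IsUpperSet {ω : BondConfig (Fin n) | openCluster ω s ∈ 𝒜} := by
  intro ω ω' hle hω
  exact h𝒜 _ _ hω (fun y hy => SimpleGraph.Reachable.mono (openGraph_mono hle) hy)

/-- The event "the cluster of `s` with `j` adjoined lies in `𝒜`" is increasing. [folklore] -/
theorem isUpperSet_clusterInsertMem (s j : Fin n) {𝒜 : Set (Set (Fin n))} (h𝒜 : ∀ S T : Set (Fin n), S ∈ 𝒜 → S ⊆ T → T ∈ 𝒜) :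
    IsUpperSet {ω : BondConfig (Fin n) | insert j (openCluster ω s) ∈ 𝒜} := by
  intro ω ω' hle hω
  exact h𝒜 _ _ hω (Set.insert_subset_insert fun y hy => SimpleGraph.Reachable.mono (openGraph_mono hle) hy)

/-! ### Measure plumbing for the pinned laws -/

/-- On a probability-one set `G`, two events that agree on `G` have the same probability. [folklore] -/
theorem real_congr_on_sure {μ : Measure (BondConfig (Fin n))} [IsProbabilityMeasure μ] {G X Y : Set (BondConfig (Fin n))}
    (hG : μ.real G = 1) (h : ∀ ω ∈ G, ω ∈ X ↔ ω ∈ Y) : μ.real X = μ.real Y := by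
  rw [real_eq_real_inter_of_real_eq_one MeasurableSet.of_discrete hG X,
    real_eq_real_inter_of_real_eq_one MeasurableSet.of_discrete hG Y]
  congr 1
  ext ω
  simp only [Set.mem_inter_iff]
  constructor
  · rintro ⟨hX, hG'⟩; exact ⟨(h ω hG').1 hX, hG'⟩
  · rintro ⟨hY, hG'⟩; exact ⟨(h ω hG').2 hY, hG'⟩

/-! ### The pendant theorem -/

/-- **W-DOMINATION AT A PENDANT TARGET.**  Let `s, i, j` be distinct, and let every pair at `j` other than `s(s,j)` have weight `0`.  Then for every
up-closed family `𝒜` of vertex sets, writing `A = {ω | C_s(ω) ∈ 𝒜}`, `B_v = {s ↔ v}`, `q_v = P(B_v)`, `q_{ij} = P(B_i ∩ B_j)`: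
`2·P(A ∩ B_i ∩ B_j) − q_j·P(A ∩ B_i) − q_i·P(A ∩ B_j) − (2q_{ij} − 2 q_i q_j)·P(A) ≥ 0`, i.e. `Cov(W_{ij}, 1_A) ≥ 0`. [this work] -/
theorem wdom_pendant (w : Sym2 (Fin n) → unitInterval) {s i j : Fin n} (hjs : j ≠ s) (hji : j ≠ i) (his : i ≠ s)
    (hpend : ∀ v : Fin n, v ≠ s → w s(j, v) = 0)
    (𝒜 : Set (Set (Fin n))) (h𝒜 : ∀ S T : Set (Fin n), S ∈ 𝒜 → S ⊆ T → T ∈ 𝒜) :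
    0 ≤ 2 * (prodBernoulli w).real ({ω | openCluster ω s ∈ 𝒜} ∩ openConn s i ∩ openConn s j)
        - (prodBernoulli w).real (openConn s j) * (prodBernoulli w).real ({ω | openCluster ω s ∈ 𝒜} ∩ openConn s i)
        - (prodBernoulli w).real (openConn s i) * (prodBernoulli w).real ({ω | openCluster ω s ∈ 𝒜} ∩ openConn s j)
        - (2 * (prodBernoulli w).real (openConn s i ∩ openConn s j)
            - 2 * ((prodBernoulli w).real (openConn s i) * (prodBernoulli w).real (openConn s j)))
          * (prodBernoulli w).real {ω | openCluster ω s ∈ 𝒜} := by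
  -- notation
  set e : Sym2 (Fin n) := s(s, j) with he
  set r : ℝ := (w e : ℝ) with hr
  set P0 := prodBernoulli (Function.update w e 0) with hP0
  set P1 := prodBernoulli (Function.update w e 1) with hP1
  set A : Set (BondConfig (Fin n)) := {ω | openCluster ω s ∈ 𝒜} with hA
  set A1 : Set (BondConfig (Fin n)) := {ω | insert j (openCluster ω s) ∈ 𝒜} with hA1
  set Bi : Set (BondConfig (Fin n)) := openConn s i with hBi
  set Bj : Set (BondConfig (Fin n)) := openConn s j with hBj
  have hr0 : 0 ≤ r := (w e).2.1
  have hr1 : r ≤ 1 := (w e).2.2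
  -- the sure set of the closed pinned law: `e` closed and every other pair at `j` closed
  set G0 : Set (BondConfig (Fin n)) :=
    {ω | ∀ f, Function.update w e 0 f = 1 → f ∈ ω} ∩ {ω | ∀ f, Function.update w e 0 f = 0 → f ∉ ω} with hG0
  have hG0 : P0.real G0 = 1 := real_sureSet _
  have hiso0 : ∀ ω ∈ G0, ∀ v : Fin n, s(j, v) ∉ ω := by
    intro ω hω v
    apply hω.2
    by_cases hv : v = s
    · subst hv; rw [Sym2.eq_swap]; simp [he]
    · have hne : s(j, v) ≠ e := by
        rw [he]; intro h; rw [Sym2.eq_iff] at h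
        rcases h with ⟨h1, _⟩ | ⟨_, h2⟩
        · exact hjs h1
        · exact hv h2
      rw [Function.update_of_ne hne]; exact hpend v hv
  have hiso0' : ∀ ω ∈ G0, ∀ v : Fin n, v ≠ s → s(j, v) ∉ ω := fun ω hω v _ => hiso0 ω hω v
  -- a.s. identities under P0 (direct side): `j` is not reached
  have hBj0 : ∀ ω ∈ G0, ω ∉ Bj := fun ω hω => not_reachable_of_isolated hjs (hiso0 ω hω)
  -- a.s. identities under P0 (inserted side)
  have hinsBj : ∀ ω ∈ G0, insert e ω ∈ Bj := fun ω _ => reachable_insert_self hjs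
  have hinsBi : ∀ ω ∈ G0, (insert e ω ∈ Bi ↔ ω ∈ Bi) := fun ω hω => reachable_insert_pendant hjs (hiso0' ω hω) hji.symm
  have hinsA : ∀ ω ∈ G0, (insert e ω ∈ A ↔ ω ∈ A1) := by
    intro ω hω
    simp only [hA, hA1, Set.mem_setOf_eq]
    rw [openCluster_insert_pendant hjs (hiso0' ω hω)]
  -- one-bond decompositions of the seven probabilities
  have dec := fun (X : Set (BondConfig (Fin n))) => stub_oneBondDecomp_k15 n w e X
  -- `P_{w[e↦1]}(X) = P_{w[e↦0]}(insert e ⁻¹ X)` (pushforward under `insert e`; as `tieLiftOne_real_one_eq`, inlined to keep this file route-independent)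
  have pre : ∀ X : Set (BondConfig (Fin n)),
      P1.real X = P0.real ((fun ω : BondConfig (Fin n) => insert e ω) ⁻¹' X) := by
    intro X
    have hmap := goodStepEI_prodBernoulli_map_insert (Function.update w e 0) e
    rw [Function.update_idem] at hmap
    have hmeas : Measurable fun ω : BondConfig (Fin n) => insert e ω := by
      refine measurable_set_iff.2 fun t => ?_
      simp only [Set.mem_insert_iff]
      exact measurable_const.or (measurable_set_mem t)
    rw [hP1, hP0, ← hmap, measureReal_def, measureReal_def, Measure.map_apply hmeas MeasurableSet.of_discrete]
  -- P1-values
  have h1_ABiBj : P1.real (A ∩ Bi ∩ Bj) = P0.real (A1 ∩ Bi) := by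
    rw [hP1, pre]
    refine real_congr_on_sure hG0 fun ω hω => ?_
    simp only [Set.mem_preimage, Set.mem_inter_iff]
    rw [hinsA ω hω, hinsBi ω hω]
    exact ⟨fun h => ⟨h.1.1, h.1.2⟩, fun h => ⟨⟨h.1, h.2⟩, hinsBj ω hω⟩⟩
  have h1_ABi : P1.real (A ∩ Bi) = P0.real (A1 ∩ Bi) := by
    rw [hP1, pre]
    refine real_congr_on_sure hG0 fun ω hω => ?_
    simp only [Set.mem_preimage, Set.mem_inter_iff]
    rw [hinsA ω hω, hinsBi ω hω]
  have h1_ABj : P1.real (A ∩ Bj) = P0.real A1 := by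
    rw [hP1, pre]
    refine real_congr_on_sure hG0 fun ω hω => ?_
    simp only [Set.mem_preimage, Set.mem_inter_iff]
    rw [hinsA ω hω]
    exact ⟨fun h => h.1, fun h => ⟨h, hinsBj ω hω⟩⟩
  have h1_A : P1.real A = P0.real A1 := by
    rw [hP1, pre]
    refine real_congr_on_sure hG0 fun ω hω => ?_
    simp only [Set.mem_preimage]
    exact hinsA ω hω
  have h1_Bi : P1.real Bi = P0.real Bi := by
    rw [hP1, pre]
    refine real_congr_on_sure hG0 fun ω hω => ?_
    simp only [Set.mem_preimage]
    exact hinsBi ω hω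
  have h1_Bj : P1.real Bj = 1 := by
    rw [hP1, pre]
    have : P0.real Set.univ = 1 := by simp [hP0]
    rw [← this]
    refine real_congr_on_sure hG0 fun ω hω => ?_
    simp only [Set.mem_preimage, Set.mem_univ, iff_true]
    exact hinsBj ω hω
  have h1_BiBj : P1.real (Bi ∩ Bj) = P0.real Bi := by
    rw [hP1, pre]
    refine real_congr_on_sure hG0 fun ω hω => ?_
    simp only [Set.mem_preimage, Set.mem_inter_iff]
    rw [hinsBi ω hω]
    exact ⟨fun h => h.1, fun h => ⟨h, hinsBj ω hω⟩⟩
  -- P0-values (direct)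
  have h0_ABiBj : P0.real (A ∩ Bi ∩ Bj) = 0 := by
    have : P0.real (∅ : Set (BondConfig (Fin n))) = 0 := by simp
    rw [← this]
    refine real_congr_on_sure hG0 fun ω hω => ?_
    simp only [Set.mem_inter_iff, Set.mem_empty_iff_false, iff_false, not_and]
    exact fun _ => hBj0 ω hω
  have h0_ABj : P0.real (A ∩ Bj) = 0 := by
    have : P0.real (∅ : Set (BondConfig (Fin n))) = 0 := by simp
    rw [← this]
    refine real_congr_on_sure hG0 fun ω hω => ?_
    simp only [Set.mem_inter_iff, Set.mem_empty_iff_false, iff_false, not_and]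
    exact fun _ => hBj0 ω hω
  have h0_Bj : P0.real Bj = 0 := by
    have : P0.real (∅ : Set (BondConfig (Fin n))) = 0 := by simp
    rw [← this]
    refine real_congr_on_sure hG0 fun ω hω => ?_
    simp only [Set.mem_empty_iff_false, iff_false]
    exact hBj0 ω hω
  have h0_BiBj : P0.real (Bi ∩ Bj) = 0 := by
    have : P0.real (∅ : Set (BondConfig (Fin n))) = 0 := by simp
    rw [← this]
    refine real_congr_on_sure hG0 fun ω hω => ?_
    simp only [Set.mem_inter_iff, Set.mem_empty_iff_false, iff_false, not_and]
    exact fun _ => hBj0 ω hω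
  -- Harris under P0 and monotonicity A ⊆ A1
  have hupA1 : IsUpperSet A1 := isUpperSet_clusterInsertMem s j h𝒜
  have hupBi : IsUpperSet Bi := isUpperSet_openConn s i
  have hHarris : P0.real A1 * P0.real Bi ≤ P0.real (A1 ∩ Bi) :=
    prodBernoulli_harris _ hupA1 hupBi MeasurableSet.of_discrete MeasurableSet.of_discrete
  have hsub : A ∩ Bi ⊆ A1 ∩ Bi := by
    intro ω hω
    exact ⟨h𝒜 _ _ hω.1 (Set.subset_insert _ _), hω.2⟩
  have hmono : P0.real (A ∩ Bi) ≤ P0.real (A1 ∩ Bi) := measureReal_mono hsub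
  have hx0 : 0 ≤ P0.real (A ∩ Bi) := measureReal_nonneg
  have hq0 : P0.real Bi ≤ 1 := measureReal_le_one
  have hy1 : 0 ≤ P0.real A1 := measureReal_nonneg
  -- rewrite everything and finish with real arithmetic
  rw [dec (A ∩ Bi ∩ Bj), dec (A ∩ Bi), dec (A ∩ Bj), dec A, dec Bi, dec Bj, dec (Bi ∩ Bj)]
  simp only [← hr]
  rw [h1_ABiBj, h1_ABi, h1_ABj, h1_A, h1_Bi, h1_Bj, h1_BiBj, h0_ABiBj, h0_ABj, h0_Bj, h0_BiBj]
  set x1 := P0.real (A1 ∩ Bi)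
  set x0 := P0.real (A ∩ Bi)
  set y1 := P0.real A1
  set y0 := P0.real A
  set q := P0.real Bi
  -- goal is r·[(2−r)x1 − (1−r)x0 − q·y1] ≥ 0 after ring normalisation
  have key : 0 ≤ (2 - r) * x1 - (1 - r) * x0 - q * y1 := by nlinarith
  have : 2 * ((1 - r) * 0 + r * x1) - ((1 - r) * 0 + r * 1) * ((1 - r) * x0 + r * x1)
      - ((1 - r) * q + r * q) * ((1 - r) * 0 + r * y1)
      - (2 * ((1 - r) * 0 + r * q) - 2 * (((1 - r) * q + r * q) * ((1 - r) * 0 + r * 1))) * ((1 - r) * y0 + r * y1)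
      = r * ((2 - r) * x1 - (1 - r) * x0 - q * y1) := by ring
  rw [this]
  exact mul_nonneg hr0 key

end IncStar

end Summit.CriticalPhenomena.PercolationContinuityZ3.Theorems
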